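import Literature.NumberTheory.Automorphic.ArchUnipotentConvTestFunction
import Literature.NumberTheory.Automorphic.MixedSpaceMomentKernelsFourier
import Literature.NumberTheory.Automorphic.WhittakerCoeffCuspidal
import Literature.NumberTheory.Automorphic.UnipotentTateDomain
import HarnessLib

/-!
# The Whittaker functional at `1` along the archimedean unipotent line of `GL_2`

Topic `NumberTheory/Automorphic`; namespace `Literature.NumberTheory.Automorphic`. Proof file
(theorems only). For the smoothed automorphic functions `S_η f (x) = ∫ η(g) f(g⁻¹ • x) dg`
(`smoothedForm`, a genuine continuous function on the automorphic quotient) and the global Whittaker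
coefficient `W_φ(g) = (ν 𝓕)⁻¹ ∫_𝓕 φ(u g) ψ̄(u) du` of `φ = invQuot (S_η f)` (Tate's character
`ψ = adeleAddChar K`, Tate's box `𝓕 = unipotentTateDomain`), we PROVE:

* `smoothedForm_leftTranslateWeight_apply` — **pointwise translation**:
  `S_{L_h η} f (x) = S_η f (h⁻¹ • x)`, hence `W_{S_η f}(g h) = W_{S_{L_h η} f}(g)`
  (`whittakerCoeff_invQuot_smoothedForm_mul`);
* `smoothedForm_archUnipotentConv_apply` — **pointwise unipotent smoothing**:
  `S_{g₀ ⋆ η} f (x) = ∫ g₀(t) S_{L_{n(t)} η} f (x) dt` (Fubini on `K_∞ × GL_2(𝔸_K)`; along an orbit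
  `g ↦ f(g⁻¹ • x)` is locally integrable by the domination of `InvariantMeasureDomination`);
* `whittakerCoeff_smoothedForm_archUnipotentConv` — **the Whittaker functional at `1` sees the
  unipotent smoothing through the kernel transform**:
  `Λ(S_{g₀ ⋆ η} f) = ĝ₀(1) · Λ(S_η f)`, `Λ(v) = W_v(1)`, `ĝ₀(1) = ∫ g₀(t) ψ_∞(t) dt = kernelTransform K g₀ 1`
  (Fubini over `𝓕 × K_∞` and the `N(𝔸)`-equivariance `W(n g) = ψ(n) W(g)`,
  `whittakerCoeff_unipotent_mul`).

This is how the Whittaker functional is recovered from a smoothing along the unipotent line in the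
Kirillov `L²`-bound (Jacquet–Shalika (1981), §4; Cogdell (2004), §1.1).

## References

* H. Jacquet, J. A. Shalika, *On Euler products and the classification of automorphic
  representations I*, Amer. J. Math. 103 (1981), §4 [JacquetShalikaAJM1981].
* J. W. Cogdell, *Analytic theory of L-functions for GL_n*, in *An Introduction to the Langlands
  Program* (2004), §1.1 [CogdellAnalyticTheory2004].
-/

noncomputable section

open scoped MatrixGroups Classical ComplexConjugate
open NumberField NumberField.mixedEmbedding IsDedekindDomain MeasureTheory Complex

namespace Literature.NumberTheory.Automorphic

variable {K : Type} [Field K] [NumberField K]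
  {μ : Measure (AdelicGroupData.gl 2 K).automorphicQuotient} [(AdelicGroupData.gl 2 K).IsAutomorphicMeasure μ]

attribute [local instance] adelicBorel borelSpace_adelic locallyCompactSpace_adelic
  secondCountableTopology_gl_adelic

/-! ### Pointwise translation -/

omit [(AdelicGroupData.gl 2 K).IsAutomorphicMeasure μ] in
/-- **`S_{L_h η} f (x) = S_η f (h⁻¹ • x)`** (substitute `g ↦ h g` in the Haar integral). [folklore] -/
theorem smoothedForm_leftTranslateWeight_apply (η : (AdelicGroupData.gl 2 K).Adelic → ℝ) (f : (AdelicGroupData.gl 2 K).L2 μ)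
    (h : (AdelicGroupData.gl 2 K).Adelic) (x : (AdelicGroupData.gl 2 K).automorphicQuotient) :
    smoothedForm (leftTranslateWeight (n := 2) h η) f x = smoothedForm η f (h⁻¹ • x) := by
  unfold smoothedForm orbitalSmoothing
  rw [← integral_mul_left_eq_self (μ := adelicHaar 2 K) _ h]
  refine integral_congr_ae (ae_of_all _ fun g => ?_)
  simp only [leftTranslateWeight_apply, inv_mul_cancel_left, mul_inv_rev, smul_smul]

omit [(AdelicGroupData.gl 2 K).IsAutomorphicMeasure μ] in
/-- `F(h⁻¹ • [g⁻¹]) = invQuot F (g h)`. [folklore] -/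
theorem apply_inv_smul_toAutomorphicQuotient_inv' (F : (AdelicGroupData.gl 2 K).automorphicQuotient → ℂ)
    (h g : (AdelicGroupData.gl 2 K).Adelic) :
    F (h⁻¹ • (AdelicGroupData.gl 2 K).toAutomorphicQuotient g⁻¹) = invQuot (AdelicGroupData.gl 2 K) F (g * h) := by
  rw [invQuot_apply, mul_inv_rev]
  rfl

omit [(AdelicGroupData.gl 2 K).IsAutomorphicMeasure μ] in
/-- **Right translation of `invQuot` of a smoothed form**: `invQuot (S_η f) (g h) = invQuot (S_{L_h η} f) (g)`.
[folklore] -/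
theorem invQuot_smoothedForm_mul (η : (AdelicGroupData.gl 2 K).Adelic → ℝ) (f : (AdelicGroupData.gl 2 K).L2 μ)
    (g h : (AdelicGroupData.gl 2 K).Adelic) :
    invQuot (AdelicGroupData.gl 2 K) (smoothedForm η f) (g * h) =
      invQuot (AdelicGroupData.gl 2 K) (smoothedForm (leftTranslateWeight (n := 2) h η) f) g := by
  rw [invQuot_apply, invQuot_apply, smoothedForm_leftTranslateWeight_apply, AdelicGroupData.smul_toAutomorphicQuotient, mul_inv_rev]

omit [(AdelicGroupData.gl 2 K).IsAutomorphicMeasure μ] in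
/-- **Right translation of the Whittaker coefficient of a smoothed form**:
`W_{S_η f}(g h) = W_{S_{L_h η} f}(g)`. [folklore] -/
theorem whittakerCoeff_invQuot_smoothedForm_mul [MeasurableSpace ↥(adelicUnipotent 2 K)] (ν : Measure ↥(adelicUnipotent 2 K))
    (𝓕 : Set ↥(adelicUnipotent 2 K)) (ψ : AddChar (AdeleRing (𝓞 K) K) Circle)
    (η : (AdelicGroupData.gl 2 K).Adelic → ℝ) (f : (AdelicGroupData.gl 2 K).L2 μ) (g h : (AdelicGroupData.gl 2 K).Adelic) :
    whittakerCoeff ν 𝓕 ψ (invQuot (AdelicGroupData.gl 2 K) (smoothedForm η f)) (g * h) =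
      whittakerCoeff ν 𝓕 ψ (invQuot (AdelicGroupData.gl 2 K) (smoothedForm (leftTranslateWeight (n := 2) h η) f)) g := by
  refine (whittakerCoeff_mul_right ν 𝓕 ψ (invQuot (AdelicGroupData.gl 2 K) (smoothedForm η f)) g h).trans ?_
  congr 1
  funext x
  exact invQuot_smoothedForm_mul η f x h

/-! ### Pointwise unipotent smoothing -/

/-- **`S_{g₀ ⋆ η} f (x) = ∫ g₀(t) S_{L_{n(t)} η} f (x) dt`** for continuous compactly supported `g₀`
on `K_∞`, `η` on `GL_2(𝔸_K)` and `f ∈ L²` (Fubini on `K_∞ × GL_2(𝔸_K)`: the joint kernel is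
continuous with compact support and `g ↦ f(g⁻¹ • x)` is integrable on compacts by domination).
[cite: JacquetShalikaAJM1981, §4] -/
theorem smoothedForm_archUnipotentConv_apply {g₀ : mixedSpace K → ℝ} (hg₀ : Continuous g₀) (hg₀s : HasCompactSupport g₀)
    {η : (AdelicGroupData.gl 2 K).Adelic → ℝ} (hη : Continuous η) (hηs : HasCompactSupport η)
    (f : (AdelicGroupData.gl 2 K).L2 μ) (x : (AdelicGroupData.gl 2 K).automorphicQuotient) :
    smoothedForm (archUnipotentConv g₀ η) f x =
      ∫ t, (g₀ t : ℂ) * smoothedForm (leftTranslateWeight (n := 2) (archUnipotentAdelic K t) η) f x := by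
  -- the joint integrand
  set k : mixedSpace K × (AdelicGroupData.gl 2 K).Adelic → ℝ := fun p => g₀ p.1 * η ((archUnipotentAdelic K p.1)⁻¹ * p.2) with hk
  have hkc : Continuous k := continuous_archUnipotentConv_kernel hg₀ hη
  have hks : HasCompactSupport k := hasCompactSupport_archUnipotentConv_kernel (K := K) hg₀s hηs
  set F : mixedSpace K × (AdelicGroupData.gl 2 K).Adelic → ℂ :=
    fun p => (k p : ℂ) * (f : (AdelicGroupData.gl 2 K).automorphicQuotient → ℂ) (p.2⁻¹ • x) with hF
  -- integrability of `F` on `K_∞ × GL_2(𝔸_K)`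
  obtain ⟨M, hM⟩ := hkc.bounded_above_of_compact_support hks
  set D : Set (AdelicGroupData.gl 2 K).Adelic := Prod.snd '' tsupport k with hD
  have hDc : IsCompact D := hks.image continuous_snd
  set T : Set (mixedSpace K) := Prod.fst '' tsupport k with hT
  have hTc : IsCompact T := hks.image continuous_fst
  have hx : IsOpenMap fun g : (AdelicGroupData.gl 2 K).Adelic => g • x := isOpenMap_smul_quotient _ _
  haveI : IsFiniteMeasure ((adelicHaar 2 K).restrict D) := ⟨by rw [Measure.restrict_apply_univ]; exact hDc.measure_lt_top⟩
  have hfD : Integrable (fun g : (AdelicGroupData.gl 2 K).Adelic => (f : (AdelicGroupData.gl 2 K).automorphicQuotient → ℂ) (g⁻¹ • x))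
      ((adelicHaar 2 K).restrict D) := by
    have h := MemLp.comp_inv_smul_of_isCompact μ (adelicHaar 2 K) hx hDc (Lp.memLp f)
    exact memLp_one_iff_integrable.1 (h.mono_exponent (p := 1) one_le_two)
  have hFint : Integrable F ((volume : Measure (mixedSpace K)).prod (adelicHaar 2 K)) := by
    -- `F` vanishes off `T × D`, where it is dominated by `M · |f(g⁻¹ • x)|`
    have hsupp : Function.support F ⊆ T ×ˢ D := by
      intro p hp
      rw [Function.mem_support, hF] at hp
      have hk0 : k p ≠ 0 := fun h0 => hp (by simp [h0])
      exact ⟨⟨p, subset_tsupport _ hk0, rfl⟩, ⟨p, subset_tsupport _ hk0, rfl⟩⟩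
    rw [← integrableOn_iff_integrable_of_support_subset hsupp, IntegrableOn, ← Measure.prod_restrict]
    haveI : IsFiniteMeasure ((volume : Measure (mixedSpace K)).restrict T) := ⟨by
      rw [Measure.restrict_apply_univ]; exact hTc.measure_lt_top⟩
    have hG : Integrable (fun p : mixedSpace K × (AdelicGroupData.gl 2 K).Adelic =>
        (1 : ℝ) * ‖(f : (AdelicGroupData.gl 2 K).automorphicQuotient → ℂ) (p.2⁻¹ • x)‖)
        (((volume : Measure (mixedSpace K)).restrict T).prod ((adelicHaar 2 K).restrict D)) :=
      Integrable.mul_prod (integrable_const (1 : ℝ)) hfD.norm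
    refine (hG.const_mul M).mono' ?_ (ae_of_all _ fun p => ?_)
    · exact ((continuous_ofReal.comp hkc).aestronglyMeasurable).mul (hfD.1.comp_quasiMeasurePreserving Measure.quasiMeasurePreserving_snd)
    · rw [hF, norm_mul, Complex.norm_real, one_mul]
      exact mul_le_mul_of_nonneg_right (hM p) (norm_nonneg _)
  -- both sides as iterated integrals of `F`
  have hlhs : smoothedForm (archUnipotentConv g₀ η) f x = ∫ g, ∫ t, F (t, g) ∂volume ∂(adelicHaar 2 K) := by
    unfold smoothedForm orbitalSmoothing
    refine integral_congr_ae (ae_of_all _ fun g => ?_)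
    show ((archUnipotentConv g₀ η g : ℝ) : ℂ) • (f : (AdelicGroupData.gl 2 K).automorphicQuotient → ℂ) (g⁻¹ • x) = _
    rw [smul_eq_mul, archUnipotentConv, ← integral_complex_ofReal, ← integral_mul_const]
  have hrhs : (∫ t, (g₀ t : ℂ) * smoothedForm (leftTranslateWeight (n := 2) (archUnipotentAdelic K t) η) f x) =
      ∫ t, ∫ g, F (t, g) ∂(adelicHaar 2 K) ∂volume := by
    refine integral_congr_ae (ae_of_all _ fun t => ?_)
    unfold smoothedForm orbitalSmoothing
    show (g₀ t : ℂ) * ∫ g, ((leftTranslateWeight (n := 2) (archUnipotentAdelic K t) η g : ℝ) : ℂ) •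
      (f : (AdelicGroupData.gl 2 K).automorphicQuotient → ℂ) (g⁻¹ • x) ∂(adelicHaar 2 K) = _
    rw [← integral_const_mul]
    refine integral_congr_ae (ae_of_all _ fun g => ?_)
    simp only [hF, hk, leftTranslateWeight_apply, smul_eq_mul, Complex.ofReal_mul, mul_assoc]
  rw [hlhs, hrhs]
  exact (integral_integral_swap hFint).symm

/-! ### The Whittaker functional at `1` and the unipotent smoothing -/

section Whittaker

variable [MeasurableSpace ↥(adelicUnipotent 2 K)] [BorelSpace ↥(adelicUnipotent 2 K)]

omit [MeasurableSpace ↥(adelicUnipotent 2 K)] [BorelSpace ↥(adelicUnipotent 2 K)] [(AdelicGroupData.gl 2 K).IsAutomorphicMeasure μ] in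
/-- The value of Tate's generic character on `n((t, 0))` is `e^{iB(1,t)}` (`archChar K 1 t`). [folklore] -/
theorem coe_whittakerCharFun_archUnipotent (t : mixedSpace K) :
    (whittakerCharFun (adeleAddChar K) ⟨archUnipotentGL K t, (unipotentGL2 (mixedInfiniteAdele K t)).2⟩ : ℂ) = archChar K 1 t :=
  coe_whittakerCharFun_adeleAddChar_unipotentGL2 t

set_option maxHeartbeats 2000000 in
/-- **The Whittaker functional at `1` sees the unipotent smoothing through the kernel transform**:
`W_{S_{g₀ ⋆ η} f}(1) = ĝ₀(1) · W_{S_η f}(1)` with `ĝ₀(1) = ∫ g₀(t) e^{iB(1,t)} dt = kernelTransform K g₀ 1`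
(Tate's character and box, any Haar measure `ν` on `N_2(𝔸_K)`). [cite: JacquetShalikaAJM1981, §4]
[cite: CogdellAnalyticTheory2004, §1.1] -/
theorem whittakerCoeff_smoothedForm_archUnipotentConv (ν : Measure ↥(adelicUnipotent 2 K)) [Measure.IsHaarMeasure ν]
    {g₀ : mixedSpace K → ℝ} (hg₀ : Continuous g₀) (hg₀s : HasCompactSupport g₀)
    {η : (AdelicGroupData.gl 2 K).Adelic → ℝ} (hη : Continuous η) (hηs : HasCompactSupport η) (f : (AdelicGroupData.gl 2 K).L2 μ) :
    whittakerCoeff ν (unipotentTateDomain 2 K) (adeleAddChar K)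
        (invQuot (AdelicGroupData.gl 2 K) (smoothedForm (archUnipotentConv g₀ η) f)) 1 =
      kernelTransform K g₀ 1 *
        whittakerCoeff ν (unipotentTateDomain 2 K) (adeleAddChar K) (invQuot (AdelicGroupData.gl 2 K) (smoothedForm η f)) 1 := by
  have hψ : IsGlobalAddChar K (adeleAddChar K) := isGlobalAddChar_adeleAddChar (K := K)
  have h𝓕 : IsFundamentalDomain ↥(rationalUnipotent 2 K) (unipotentTateDomain 2 K) ν := isFundamentalDomain_unipotentTateDomain ν
  have h𝓕c : IsCompact (closure (unipotentTateDomain 2 K)) := isCompact_closure_unipotentTateDomain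
  have h𝓕m : MeasurableSet (unipotentTateDomain 2 K) := measurableSet_unipotentTateDomain
  haveI := isMulRightInvariant_of_isHaarMeasure_adelicUnipotent ν
  set φ : GL (Fin 2) (AdeleRing (𝓞 K) K) → ℂ := invQuot (AdelicGroupData.gl 2 K) (smoothedForm η f) with hφ
  have hφinv : IsLeftInvariant (AdelicGroupData.gl 2 K) φ := isLeftInvariant_invQuot _ _
  have hφc : Continuous φ := (continuous_smoothedForm hη hηs _).comp
    ((AdelicGroupData.gl 2 K).continuous_toAutomorphicQuotient.comp (continuous_inv : Continuous fun g : (AdelicGroupData.gl 2 K).Adelic => g⁻¹))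
  -- the smoothed form along the line: `invQuot (S_{g₀⋆η} f)(u) = ∫ g₀(t) φ(u n(t)) dt`
  have hline : ∀ u : GL (Fin 2) (AdeleRing (𝓞 K) K),
      invQuot (AdelicGroupData.gl 2 K) (smoothedForm (archUnipotentConv g₀ η) f) u = ∫ t, (g₀ t : ℂ) * φ (u * archUnipotentGL K t) := by
    intro u
    rw [invQuot_apply, smoothedForm_archUnipotentConv_apply hg₀ hg₀s hη hηs]
    refine integral_congr_ae (ae_of_all _ fun t => ?_)
    show (g₀ t : ℂ) * invQuot (AdelicGroupData.gl 2 K) (smoothedForm (leftTranslateWeight (n := 2) (archUnipotentAdelic K t) η) f) u =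
      (g₀ t : ℂ) * φ (u * archUnipotentGL K t)
    rw [← invQuot_smoothedForm_mul]
    rfl
  -- the joint integrand on `𝓕 × K_∞`
  set G : ↥(adelicUnipotent 2 K) × mixedSpace K → ℂ := fun p =>
    (g₀ p.2 : ℂ) * φ ((p.1 : GL (Fin 2) (AdeleRing (𝓞 K) K)) * archUnipotentGL K p.2) * conj (whittakerCharFun (adeleAddChar K) p.1 : ℂ)
    with hG
  have hGc : Continuous G := by
    refine (((continuous_ofReal.comp hg₀).comp continuous_snd).mul (hφc.comp
      ((continuous_subtype_val.comp continuous_fst).mul ((continuous_archUnipotentAdelic.comp continuous_snd : Continuous fun p : ↥(adelicUnipotent 2 K) × mixedSpace K => archUnipotentGL K p.2))))).mul ?_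
    exact ((continuous_whittakerCharFun hψ.continuous).comp continuous_fst).star
  -- integrability on `(ν|𝓕) × volume`: bounded, supported in `𝓕 × supp g₀`
  haveI hfin : IsFiniteMeasure (ν.restrict (unipotentTateDomain 2 K)) :=
    isFiniteMeasure_restrict.2 ((measure_mono subset_closure).trans_lt h𝓕c.measure_lt_top).ne
  have hGint : Integrable G ((ν.restrict (unipotentTateDomain 2 K)).prod (volume : Measure (mixedSpace K))) := by
    -- a bound on the compact set `closure 𝓕 × tsupport g₀`
    obtain ⟨M, hM⟩ := ((h𝓕c.prod hg₀s).bddAbove_image hGc.norm.continuousOn)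
    have hM' : ∀ p ∈ closure (unipotentTateDomain 2 K) ×ˢ tsupport g₀, ‖G p‖ ≤ M := fun p hp => hM ⟨p, hp, rfl⟩
    -- pointwise domination off and on the support of `g₀`
    have hdom : ∀ u ∈ unipotentTateDomain 2 K, ∀ t, ‖G (u, t)‖ ≤ (tsupport g₀).indicator (fun _ => max M 0) t := by
      intro u hu t
      by_cases ht : t ∈ tsupport g₀
      · rw [Set.indicator_of_mem ht]
        exact (hM' (u, t) ⟨subset_closure hu, ht⟩).trans (le_max_left _ _)
      · rw [Set.indicator_of_notMem ht, hG]
        simp only [image_eq_zero_of_notMem_tsupport ht, Complex.ofReal_zero, zero_mul, norm_zero, le_refl]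
    have hTint : Integrable ((tsupport g₀).indicator fun _ : mixedSpace K => max M 0) (volume : Measure (mixedSpace K)) :=
      (integrable_indicator_iff (isClosed_tsupport g₀).measurableSet).2 (integrableOn_const hg₀s.measure_lt_top.ne)
    have hbound : Integrable (fun p : ↥(adelicUnipotent 2 K) × mixedSpace K => (1 : ℝ) * (tsupport g₀).indicator (fun _ => max M 0) p.2)
        ((ν.restrict (unipotentTateDomain 2 K)).prod (volume : Measure (mixedSpace K))) :=
      Integrable.mul_prod (integrable_const (1 : ℝ)) hTint
    refine hbound.mono' hGc.aestronglyMeasurable ?_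
    rw [Measure.ae_prod_iff_ae_ae]
    · rw [ae_restrict_iff' h𝓕m]
      exact ae_of_all _ fun u hu => ae_of_all _ fun t => by rw [one_mul]; exact hdom u hu t
    · exact measurableSet_le hGc.norm.measurable ((measurable_const.indicator (isClosed_tsupport g₀).measurableSet).comp measurable_snd |>.const_mul 1)
  -- the normalising constant
  set c : ℝ := (ν (unipotentTateDomain 2 K)).toReal⁻¹ with hc
  -- left-hand side as an iterated integral
  have hlhs : whittakerCoeff ν (unipotentTateDomain 2 K) (adeleAddChar K)
      (invQuot (AdelicGroupData.gl 2 K) (smoothedForm (archUnipotentConv g₀ η) f)) 1 =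
      c • ∫ u in unipotentTateDomain 2 K, ∫ t, G (u, t) ∂volume ∂ν := by
    rw [whittakerCoeff_def]
    congr 1
    refine integral_congr_ae (ae_of_all _ fun u => ?_)
    show invQuot (AdelicGroupData.gl 2 K) (smoothedForm (archUnipotentConv g₀ η) f) ((u : GL (Fin 2) (AdeleRing (𝓞 K) K)) * (1 : GL (Fin 2) (AdeleRing (𝓞 K) K))) *
      conj (whittakerCharFun (adeleAddChar K) u : ℂ) = ∫ t, G (u, t)
    rw [mul_one, hline, ← integral_mul_const]
  -- Fubini and the `N(𝔸)`-equivariance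
  have hinner : ∀ t : mixedSpace K, c • ∫ u in unipotentTateDomain 2 K, φ ((u : GL (Fin 2) (AdeleRing (𝓞 K) K)) * archUnipotentGL K t) *
      conj (whittakerCharFun (adeleAddChar K) u : ℂ) ∂ν =
      archChar K 1 t * whittakerCoeff ν (unipotentTateDomain 2 K) (adeleAddChar K) φ 1 := by
    intro t
    have h1 : c • ∫ u in unipotentTateDomain 2 K, φ ((u : GL (Fin 2) (AdeleRing (𝓞 K) K)) * archUnipotentGL K t) *
        conj (whittakerCharFun (adeleAddChar K) u : ℂ) ∂ν =
        whittakerCoeff ν (unipotentTateDomain 2 K) (adeleAddChar K) φ (archUnipotentGL K t) := by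
      rw [whittakerCoeff_def]
    rw [h1]
    have hmem : archUnipotentGL K t ∈ adelicUnipotent 2 K := (unipotentGL2 (mixedInfiniteAdele K t)).2
    have h2 := whittakerCoeff_unipotent_mul (ν := ν) (𝓕 := unipotentTateDomain 2 K) (ψ := adeleAddChar K)
      h𝓕 hψ hφinv ⟨archUnipotentGL K t, hmem⟩ 1
    rw [mul_one] at h2
    rw [h2, coe_whittakerCharFun_archUnipotent]
  rw [hlhs, integral_integral_swap hGint]
  -- `c • ∫_t ∫_𝓕 G = ∫_t g₀(t) · (c • ∫_𝓕 φ(u n(t)) ψ̄(u)) = ∫_t g₀(t) ψ_∞(t) · W_φ(1)`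
  have hpt : ∀ t : mixedSpace K, (∫ u in unipotentTateDomain 2 K, G (u, t) ∂ν) =
      (g₀ t : ℂ) * ∫ u in unipotentTateDomain 2 K, φ ((u : GL (Fin 2) (AdeleRing (𝓞 K) K)) * archUnipotentGL K t) *
        conj (whittakerCharFun (adeleAddChar K) u : ℂ) ∂ν := by
    intro t
    rw [← integral_const_mul]
    refine integral_congr_ae (ae_of_all _ fun u => ?_)
    simp only [hG, mul_assoc]
  simp_rw [hpt]
  rw [← integral_smul, kernelTransform, ← integral_mul_const]
  refine integral_congr_ae (ae_of_all _ fun t => ?_)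
  show c • ((g₀ t : ℂ) * ∫ u in unipotentTateDomain 2 K, φ ((u : GL (Fin 2) (AdeleRing (𝓞 K) K)) * archUnipotentGL K t) *
      conj (whittakerCharFun (adeleAddChar K) u : ℂ) ∂ν) = (g₀ t : ℂ) * archChar K 1 t * whittakerCoeff ν (unipotentTateDomain 2 K) (adeleAddChar K) φ 1
  rw [← mul_smul_comm, hinner t, mul_assoc]

end Whittaker

end Literature.NumberTheory.Automorphic
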